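import Literature.NumberTheory.EllipticCurves.BSDRootNumberStripProofs
import Literature.NumberTheory.Automorphic.BCDTTheoremB
import Literature.NumberTheory.Automorphic.BCDTModularitySerreProofs
import HarnessLib

/-!
# `Λ_raw(2 − s) = w(E) Λ_raw(s)` on `0 < re s < 2`: the trust base of
`Literature.NumberTheory.EllipticCurves.completedLFunction_functional_equation_strip` in the tree

A `…Proofs` sibling (theorems only: no definition, no named fact, no instance; nothing in
`Literature.NumberTheory.EllipticCurves.BSDRootNumber` is restated or changed) written by the
tenured seat of the named fact `completedLFunction_functional_equation_strip W` (**bsd.S08**, raw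
product form): for an elliptic `W / ℚ` of conductor `N_E = W.conductorNorm ℤ` and `0 < re s < 2`,
`Λ_raw(2 − s) = w(E) Λ_raw(s)` where `Λ_raw(s) = W.completedLFunction N_E s =
N_E^{s/2} (2π)^{-s} Γ(s) L(E, s)` and `w(E) = W.rootNumber` — Silverman, *The Arithmetic of
Elliptic Curves*, 2nd ed., App. C §16, Thm. 16.3 (p. 451), restricted to the strip where Mathlib's
`Complex.Gamma` has no junk zero; source of the theorem: the Modularity Theorem,
Breuil–Conrad–Diamond–Taylor, J. Amer. Math. Soc. 14 (2001), **Theorem A** (p. 843: "If `E/ℚ` is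
an elliptic curve, then `E` is modular"), in the form of condition (2) of their list (1)–(6)
(p. 845: "`L(E, s) = L(f, s)` for some eigenform `f` of weight `2` and level `N(E)`"), combined
with Hecke's functional equation for the newform `f`.

## Status (2026-08-15) and what this file records

Everything between modularity and the fact is a theorem of the tree
(`BSDRootNumberStripProofs`: `completedLFunction_functional_equation_strip_of_isNewformOf` per
curve, `completedLFunction_functional_equation_strip_of_exists_isNewformOf` from the single named
fact `Literature.NumberTheory.EllipticCurves.ModularForms.exists_isNewformOf` = Thm. A, and
`…_of_theoremB_of_CDT` from {Thm. B, CDT Thm. 7.2.4}; axiom closure of all three: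
`propext`, `Classical.choice`, `Quot.sound`). Since that file landed, the Modularity Theorem has
been unfolded further in `Literature/NumberTheory/Automorphic/`:

* `CDTModularityProofs`: CDT Thm. 7.2.4 from CDT Thms. 7.1.2, 7.2.2 and Ogg–Saito for `V₅ E`
  (`exists_isNewformOf_of_theoremB_of_CDT712_722`);
* `BCDTTheoremB`: Theorem B (= Thm. 2.2.1) from its printed inputs — the wild cases 2–6 of the
  proof of Thm. 2.2.1, the [SBT]/[Man] auxiliary curve, CDT Thm. 7.1.2 and Ogg–Saito
  (`exists_isNewformOf_of_wild_of_auxiliaryCurve_of_CDT712_722`);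
* `BCDTModularitySerreProofs`: Theorem B as the `𝔽₅`, cyclotomic-determinant case of Serre's
  conjecture (3.2.3) (Khare–Wintenberger 2009) (`exists_isNewformOf_of_serre_of_CDT712_722`).

This file composes these with the end of chain of `BSDRootNumberStripProofs`, so that each trust
base of the strip fact available in the tree is ONE searchable theorem (the companions for the
sibling facts are `AnalyticRankBCDTProofs` and `RootNumberBCDTProofs`):

* `forall_completedLFunction_functional_equation_strip_of_exists_isNewformOf` — the shape
  `exists_isNewformOf → ∀ W, …` in which a future `exists_isNewformOf_holds` closes the fact;
* `completedLFunction_functional_equation_strip_of_theoremB_of_CDT712_722` — trust base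
  {BCDT Thm. B, CDT Thm. 7.1.2, CDT Thm. 7.2.2, Ogg–Saito for `V₅ E`};
* `completedLFunction_functional_equation_strip_of_wild_of_auxiliaryCurve_of_CDT712_722` — trust
  base {BCDT Thm. 2.2.1 cases 2–6, the [SBT] auxiliary curve, CDT Thms. 7.1.2, 7.2.2, Ogg–Saito},
  the finest one in the tree;
* `completedLFunction_functional_equation_strip_of_serre_of_CDT712_722` — the alternative
  {Serre (3.2.3) at `p = 5`, CDT Thms. 7.1.2, 7.2.2, Ogg–Saito}.

## What is NOT here, and why `completedLFunction_functional_equation_strip_holds` is not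

The unconditional discharge would be
`completedLFunction_functional_equation_strip_of_exists_isNewformOf W exists_isNewformOf_holds`;
`exists_isNewformOf_holds` is the Modularity Theorem for every elliptic curve over `ℚ` (Wiles 1995,
Taylor–Wiles 1995, Diamond 1996, Conrad–Diamond–Taylor 1999, BCDT 2001), whose remaining leaves
above rest on `p`-adic Hodge theory, Galois deformation rings and Hecke algebras of modular
Jacobians, none of which is in Mathlib. No weaker input suffices for the fact as stated: on
`3/2 < re s < 2` the right-hand side is `w(E) N_E^{s/2} (2π)^{-s} Γ(s) L(E, s) ≠ 0` (convergent
Euler product), so the fact asserts in particular that the chosen continuation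
`W.entireLFunction` at `2 − s`, `0 < re (2 − s) < 1/2`, is governed by `L(E, s)` — i.e. the
analytic continuation of `L(E, ·)` across the critical strip with its functional equation at
level `N_E`, for every `E / ℚ`, known only through modularity (Deuring's theorem covers CM curves
only). The fact therefore stays a named fact; users take
`(h : completedLFunction_functional_equation_strip W)`, fed per curve by
`completedLFunction_functional_equation_strip_of_isNewformOf` when a newform is in hand.

## References

* C. Breuil, B. Conrad, F. Diamond, R. Taylor, *On the modularity of elliptic curves over `ℚ`:
  wild 3-adic exercises*, J. Amer. Math. Soc. 14 (2001), 843–939: Thms. A, B (p. 843), conditions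
  (1)–(6) (p. 845), Thm. 2.2.1 and Thm. 2.2.2 (§2.2, "Combining this theorem with Theorem 7.2.4 of
  [CDT] we immediately obtain …").
* B. Conrad, F. Diamond, R. Taylor, *Modularity of certain potentially Barsotti–Tate Galois
  representations*, J. Amer. Math. Soc. 12 (1999), 521–567: Thms. 7.1.2, 7.2.2, 7.2.4.
* C. Khare, J.-P. Wintenberger, *Serre's modularity conjecture (I)*, Invent. Math. 178 (2009),
  Thm. 1.2; J.-P. Serre, Duke Math. J. 54 (1987), (3.2.3).
* J. H. Silverman, *The Arithmetic of Elliptic Curves*, 2nd ed., GTM 106 (2009), App. C §16,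
  Thm. 16.3 (p. 451).
-/

noncomputable section

namespace Literature.NumberTheory.EllipticCurves

open Literature.NumberTheory.Automorphic.BCDT

/-- **The shape of the discharge.** The Modularity Theorem, Version `L`
(`Literature.NumberTheory.EllipticCurves.ModularForms.exists_isNewformOf`: BCDT 2001, Thm. A, in
the form (2) of p. 845; Diamond–Shurman Thm. 8.8.3) implies the strip fact for every `W`
(`completedLFunction_functional_equation_strip_of_exists_isNewformOf`, arguments reordered): once
`exists_isNewformOf_holds` is a theorem of the tree,
`completedLFunction_functional_equation_strip_holds` is this theorem applied to it.
[cite: BCDTJAMS2001, Theorem A and p. 845 (2)] -/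
theorem forall_completedLFunction_functional_equation_strip_of_exists_isNewformOf
    (hmod : Literature.NumberTheory.EllipticCurves.ModularForms.exists_isNewformOf)
    (W : WeierstrassCurve ℚ) : completedLFunction_functional_equation_strip W :=
  completedLFunction_functional_equation_strip_of_exists_isNewformOf W hmod

variable (W : WeierstrassCurve ℚ)

/-- **bsd.S08 on the strip from BCDT Theorem B, CDT Theorems 7.1.2 and 7.2.2, and Ogg–Saito for
`V₅ E`.** `completedLFunction_functional_equation_strip W` from Breuil–Conrad–Diamond–Taylor's
Theorem B (= Thm. 2.2.1, `theoremB`), Conrad–Diamond–Taylor's Thms. 7.1.2 and 7.2.2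
(`CDT_theorem_7_1_2`, `CDT_theorem_7_2_2`) and Ogg–Saito in Galois form at `ℓ = 5`
(`WeierstrassCurve.artinConductorExponent_tate_eq_conductorExponent_of_isElliptic · 5`): these give
CDT Thm. 7.2.4 (`CDT_theorem_7_2_4_of_7_1_2_of_7_2_2`), hence Thm. 2.2.2 = Thm. A
(`exists_isNewformOf_of_theoremB_of_CDT712_722`, BCDT §2.2), hence the strip fact
(`completedLFunction_functional_equation_strip_of_exists_isNewformOf`). Trust base recorded:
{BCDT Thm. B, CDT Thm. 7.1.2, CDT Thm. 7.2.2, Ogg–Saito for `V₅ E`}.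
[cite: BCDTJAMS2001, Theorem 2.2.1 and Theorem 2.2.2 (§2.2)]
[cite: ConradDiamondTaylor1999, Thms. 7.1.2, 7.2.2, 7.2.4] -/
theorem completedLFunction_functional_equation_strip_of_theoremB_of_CDT712_722 (hB : theoremB)
    (h712 : CDT_theorem_7_1_2) (h722 : CDT_theorem_7_2_2)
    (hOgg : ∀ E : WeierstrassCurve ℚ,
      E.artinConductorExponent_tate_eq_conductorExponent_of_isElliptic 5) :
    completedLFunction_functional_equation_strip W :=
  completedLFunction_functional_equation_strip_of_exists_isNewformOf W
    (exists_isNewformOf_of_theoremB_of_CDT712_722 hB h712 h722 hOgg)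

/-- **bsd.S08 on the strip with Theorem B unfolded one level** (the finest trust base in the
tree). `completedLFunction_functional_equation_strip W` from the printed inputs of the proof of
BCDT Thm. 2.2.1 (§2.2) as vendored in `BCDTTheoremB` — the wild cases 2–6
(`exists_isTorsionGaloisRep_and_isModular_of_not_isTamelyRamifiedAbove`: Thms. 1.4.1–1.4.2,
2.1.2, 2.1.4, 2.1.6, Langlands–Tunnell) and the auxiliary elliptic curve with `E[5] ≅ ρ̄` and
`ρ̄_{E,3}` surjective (`exists_isTorsionGaloisRep_five_and_surjective_three`, [SBT] §1, [Man]) —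
together with CDT Thms. 7.1.2, 7.2.2 and Ogg–Saito for `V₅ E`, via
`exists_isNewformOf_of_wild_of_auxiliaryCurve_of_CDT712_722`. Trust base recorded:
{BCDT Thm. 2.2.1 cases 2–6, the [SBT] auxiliary curve, CDT Thm. 7.1.2, CDT Thm. 7.2.2, Ogg–Saito
for `V₅ E`}. [cite: BCDTJAMS2001, proof of Theorem 2.2.1 (§2.2) and Theorem A] -/
theorem completedLFunction_functional_equation_strip_of_wild_of_auxiliaryCurve_of_CDT712_722
    (hwild : exists_isTorsionGaloisRep_and_isModular_of_not_isTamelyRamifiedAbove)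
    (haux : exists_isTorsionGaloisRep_five_and_surjective_three) (h712 : CDT_theorem_7_1_2)
    (h722 : CDT_theorem_7_2_2)
    (hOgg : ∀ E : WeierstrassCurve ℚ,
      E.artinConductorExponent_tate_eq_conductorExponent_of_isElliptic 5) :
    completedLFunction_functional_equation_strip W :=
  completedLFunction_functional_equation_strip_of_exists_isNewformOf W
    (exists_isNewformOf_of_wild_of_auxiliaryCurve_of_CDT712_722 hwild haux h712 h722 hOgg)

/-- **bsd.S08 on the strip from Serre's conjecture at `p = 5` and Conrad–Diamond–Taylor.**
`completedLFunction_functional_equation_strip W` from Serre's conjecture (3.2.3) at `p = 5`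
(`Literature.NumberTheory.Automorphic.exists_newform_of_odd_irreducible`, a theorem of
Khare–Wintenberger 2009, Thm. 1.2; BCDT, Introduction, p. 845: "Serre has conjectured that all
odd, irreducible `ρ̄` are strongly modular"), which implies Theorem B
(`theoremB_of_exists_newform_of_odd_irreducible`, `BCDTModularitySerreProofs`), together with
CDT Thms. 7.1.2, 7.2.2 and Ogg–Saito for `V₅ E` (`exists_isNewformOf_of_serre_of_CDT712_722`).
Alternative trust base recorded: {Serre (3.2.3) at `p = 5`, CDT Thm. 7.1.2, CDT Thm. 7.2.2,
Ogg–Saito for `V₅ E`} (not finer than Theorem B's own: Khare–Wintenberger rests on far more).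
[cite: BCDTJAMS2001, Theorem 2.2.2 and Introduction p. 845]
[cite: KhareWintenberger2009, Thm. 1.2] -/
theorem completedLFunction_functional_equation_strip_of_serre_of_CDT712_722
    (hSerre : ∀ (k : Type) [Field k] [TopologicalSpace k] [DiscreteTopology k],
      Literature.NumberTheory.Automorphic.exists_newform_of_odd_irreducible (p := 5) (k := k))
    (h712 : CDT_theorem_7_1_2) (h722 : CDT_theorem_7_2_2)
    (hOgg : ∀ E : WeierstrassCurve ℚ,
      E.artinConductorExponent_tate_eq_conductorExponent_of_isElliptic 5) :
    completedLFunction_functional_equation_strip W :=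
  completedLFunction_functional_equation_strip_of_exists_isNewformOf W
    (exists_isNewformOf_of_serre_of_CDT712_722 hSerre h712 h722 hOgg)

end Literature.NumberTheory.EllipticCurves

end
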